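/-
Copyright: the b2b-balaban T⁴-continuum CRUX team, row NE7b OWNER lineage `t4-ne7b-p1` (gen 122). Project licence.
-/
import Summits.QuantumFields.BalabanUV.T4Continuum.Spine.NE7b.SupTorusBlockL1Letter

/-!
# THE BLOCK-`ℓ¹` NORMS OF `H_V⁻¹f` INHERIT THE SOURCE'S EXPONENTIAL SUP PROFILE ON THE ROAD'S CLASS `V ≥ −λ`, AND THE LOCAL LETTERS OF
# WEIGHTED INTERIOR REGULARITY: `|f| ≤ M·e^{−γρ_s(bt ·, y₀)}` ⟹ `Σ_{B_y}|u| ≤ (n+1)^d·m_κ⁻¹e^{2dκ}·M·K_δ·e^{−δρ_s(y,y₀)}` (duality against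
# SIGN sources ⊛ (138)'s coarse convolution); near lattice blocks periodise to `ρ_s`-close torus blocks; the second-difference sum at a
# site from the equation — the inputs of the next file's pointwise DECAY on the road's class (row NE7b, node U5c; (133)∕(138)∕(144)∕(148)∕
# (151) BY NAME; [folklore])

Cell `pub-balaban`, sub-cell `t4`, spine estimate NE7b (`T4WeightBudget.RelWeightBound`; the cell's OWN estimate — NOT PRINTED in
[Bałaban 1983–89], NOT PROVED).  Crux-route work under `Spine/NE7b/` by the row OWNER (`t4-ne7b-p1` gen 122, file (153)) under FREEZE
(0)'s crux-prover clause; NOTHING of Bałaban's is named as a Lean object, valued or asserted; no `T4Continuum/Support` leaf typed; no `def`,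
no notation (the action DISPLAYED exactly as in (133)–(152)); zero `sorry`.  Imports (BY NAME): the OWNER's (151) `…SupTorusBlockL1Letter`
(`floor_pos_of_rate`, `cube_subset_blocks`, `card_nearBlocks`; through it (148) `action_surjective`, (144) `blockTerm_eq`, (138)
`blockSq_le_of_block_source`, `coarse_convolution_le`, (133) `action_form_symm`, `sum_indicator_mul`, (132) `isPseudoDist_torus`,
`natAbs_valMinAbs_le_of_intCast_eq`, [B6] `B_disjoint`, the torus dictionary).

WHY (located).  (152) bounds `‖H_V⁻¹‖_{∞→∞}` on the road's class by interior regularity; to LOCALISE the same argument (next file) every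
quantity on the cube of radius `3m ≤ n+1` about a representative must carry the profile `e^{−δρ_s(·, y₀)}` of the source: the block means do
by (149) `blockMean_le_of_supProfile`; the block-`ℓ¹` norms do by §1 — duality ((133) `action_form_symm`) against the sign source
`g = 𝟙_{B_y}·sgn u`: `Σ_{B_y}|u| = ⟨H⁻¹g, f⟩`, the pairing read blockwise against `|f| ≤ M·e^{−γρ_s(·,y₀)}` with `‖H⁻¹g‖_{ℓ¹(B_{y′})} ≤
(n+1)^d·m_κ⁻¹e^{2dκ}e^{−κρ_s(y′,y)}` (Cauchy–Schwarz on (138) `blockSq_le_of_block_source`, `Σg² ≤ (n+1)^d`), then (138)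
`coarse_convolution_le`; near lattice blocks (`‖b − c‖_∞ ≤ 1`) periodise to torus blocks at `ρ_s`-distance `≤ d` (§2), so profiles on the
cube cost a factor `e^{dδ}`; and the displayed equation bounds the second-difference sum at a site by its local data (§2).

WHAT IS PROVED ([folklore]; fine torus `Site d ((n+1)s)`, coarse `Site d s`, `[NeZero s]`; the action DISPLAYED; `σ = siteOf`, `bt x =
σ_s(blk n (wm x))`, `ρ_s` the `ℓ¹` circular distance; `m_κ = min(2,a) − λ − 2dκ² − a(e^{2dκ} − 1)`; `K_δ = (2∕(1 − e^{−δ}))^d`):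
* §1 `unitBlockSource_blockL1_le` (`g` supported in the block `y`, `|g| ≤ 1`, `Hv = g` ⟹ `Σ_{B_{y′}}|v∘σ| ≤ (n+1)^d·m_κ⁻¹e^{2dκ}·e^{−κρ_s(y′,y)}`);
  **`blockL1_le_of_supProfile`** (`|f| ≤ M·e^{−γρ_s(bt ·,y₀)}`, `δ ≤ κ`, `2δ ≤ γ`, `Hu = f` ⟹ `Σ_z|u(σ(chart n (wm y) z))| ≤
  (n+1)^d·m_κ⁻¹e^{2dκ}·M·K_δ·e^{−δρ_s(y,y₀)}` — road's class, no support condition).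
* §2 `near_dist_le` (`|b i − c i| ≤ 1` ∀ `i` ⟹ `ρ_s(σ_s b, σ_s c) ≤ d`); `sum_cube_le_of_near` (cube `ℓ¹` from the `3^d` NEAR block sums);
  `laplacian_site_le` (`Hu = f`, `|f x′| ≤ ME′`, `|u x′| ≤ E′S`, `|V x′| ≤ L`, block mean `≤ Cd·M·E′` ⟹ `|Σ_μ(2u x′ − u(x′ ± ê_μ))| ≤
  E′(M + LS + aCdM)∕(n+1)²`).
* §3 toy.

HONEST (what this is NOT).  Letters only; rates far from sharp; cubic periods; scalar skeleton ((A3), NC-NE7b-α UNRULED); nothing of the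
covariant propagators of [B4]–[B6]; nothing of Bałaban's.  BY-NAME EFFECT ON THE WALL: NONE.  NE7b NOT PRINTED ∕ NOT PROVED; spine PROVED
0∕9; rung (B)+1 on a FINITE torus — NOT infinite volume, NOT the mass gap, NOT Clay.  HONEST DEPENDENCY: continuum YM on T⁴ ⇐ BetaPertH ∧
nine spine estimates (0∕9 proved); BetaPertH ⇐ (D1) ∧ (D4) ∧ CAP+tail; G-an2-4 gates asym, D1 and NE2∕3∕4.
-/

set_option autoImplicit false

noncomputable section

namespace Summit.QuantumFields.BalabanUV.T4Continuum.NE7b.SupTorusBlockL1Profile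

open Real
open Literature.MathematicalPhysics.QuantumFieldTheory.Balaban1983to89
open B6QGQLower276 (X e blk B side chart mem_B sum_B sum_B_const card_cube blk_chart B_disjoint)
open Beta (Site siteOf windowMap siteOf_windowMap siteOf_add siteOf_sub)
open Beta.PoissonInterior (cube mem_cube)
open SupTorusDirichletForm (sum_fine_eq_sum_blocks blockOf_siteOf_of_mem)
open SupTorusBlockDistance (isPseudoDist_torus natAbs_valMinAbs_le_of_intCast_eq)
open SupTorusActionForm (action_form_symm sum_indicator_mul)
open SupTorusPropagatorLocality (coarse_convolution_le blockSq_le_of_block_source)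
open SupTorusMaximumPrinciple (blockTerm_eq)
open SupTorusSupNormBound (action_surjective)
open SupTorusBlockL1Letter (floor_pos_of_rate cube_subset_blocks card_nearBlocks)

variable {d : ℕ}

/-! ## §1. The block-`ℓ¹` norms of `H⁻¹f` inherit the sup profile of `f` (road's class `V ≥ −λ`) -/

section Profile

variable (n : ℕ) (a : ℝ) (s : ℕ) [NeZero s] (ha : 0 ≤ a) {lam κ δ γ M : ℝ} (hκ0 : 0 < κ) (hκ1 : κ ≤ 1)
  (hm : 0 < min 2 a - lam - 2 * d * κ ^ 2 - a * (exp (2 * d * κ) - 1)) (hδ : 0 < δ) (hδκ : δ ≤ κ) (h2δ : 2 * δ ≤ γ)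
  (V : Site d ((n + 1) * s) → ℝ) (hV : ∀ x, -lam ≤ V x)

include ha hκ0 hκ1 hm hV in
/-- **A UNIT SOURCE IN ONE BLOCK HAS BLOCK-`ℓ¹`-LOCAL `H⁻¹`**: `g` supported in the block `y` with `|g| ≤ 1` and `Hv = g` ⟹ over every block `y′`,
`Σ_{p ∈ B n (wm y′)}|v(σ p)| ≤ (n+1)^d·m_κ⁻¹e^{2dκ}·e^{−κρ_s(y′,y)}` (Cauchy–Schwarz on (138) `blockSq_le_of_block_source`, `Σg² ≤ (n+1)^d`). [folklore] -/
theorem unitBlockSource_blockL1_le (y : Site d s) (v g : Site d ((n + 1) * s) → ℝ)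
    (hg : ∀ x, siteOf d s (blk n (windowMap d ((n + 1) * s) x)) ≠ y → g x = 0) (hg1 : ∀ x, |g x| ≤ 1)
    (hv : ∀ x, ((n : ℝ) + 1) ^ 2 * ∑ μ, (2 * v x - v (x + siteOf d ((n + 1) * s) (e μ)) - v (x - siteOf d ((n + 1) * s) (e μ)))
      + a / ((n : ℝ) + 1) ^ d * ∑ q ∈ B n (blk n (windowMap d ((n + 1) * s) x)), v (siteOf d ((n + 1) * s) q) + V x * v x = g x)
    (y' : Site d s) :
    ∑ p ∈ B n (windowMap d s y'), |v (siteOf d ((n + 1) * s) p)|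
      ≤ ((n : ℝ) + 1) ^ d * ((min 2 a - lam - 2 * d * κ ^ 2 - a * (exp (2 * d * κ) - 1))⁻¹ * exp (2 * d * κ))
        * exp (-(κ * ∑ i, (((y' i - y i).valMinAbs.natAbs : ℕ) : ℝ))) := by
  classical
  set m := min 2 a - lam - 2 * d * κ ^ 2 - a * (exp (2 * d * κ) - 1) with hm_def
  have hvol : (0 : ℝ) < ((n : ℝ) + 1) ^ d := by positivity
  have hminv : 0 ≤ m⁻¹ := inv_nonneg.2 hm.le
  have hg2 : ∑ x, g x ^ 2 ≤ ((n : ℝ) + 1) ^ d := by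
    have e1 : ∀ x, g x ^ 2 ≤ (if siteOf d s (blk n (windowMap d ((n + 1) * s) x)) = y then (1 : ℝ) else 0) * 1 := fun x => by
      by_cases hx : siteOf d s (blk n (windowMap d ((n + 1) * s) x)) = y
      · rw [if_pos hx, one_mul, ← sq_abs]
        have h := hg1 x
        have h0 := abs_nonneg (g x)
        nlinarith
      · rw [if_neg hx, hg x hx]; simp
    refine (Finset.sum_le_sum fun x _ => e1 x).trans (le_of_eq ?_)
    rw [sum_indicator_mul n s y (fun _ => (1 : ℝ)), Finset.sum_const, Finset.card_univ, nsmul_eq_mul, mul_one, card_cube]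
  rw [sum_B]
  have hCS := sq_sum_le_card_mul_sum_sq (s := (Finset.univ : Finset (Fin d → Fin (n + 1))))
    (f := fun z => |v (siteOf d ((n + 1) * s) (chart n (windowMap d s y') z))|)
  rw [Finset.card_univ, card_cube] at hCS
  simp only [sq_abs] at hCS
  have hcol := blockSq_le_of_block_source n a s ha hκ0.le hκ1 hm V hV y v g hg hv y'
  have h4 : exp (4 * d * κ) = exp (2 * d * κ) ^ 2 := by rw [sq, ← exp_add]; ring_nf
  have h5 : exp (-(2 * κ * ∑ i, (((y' i - y i).valMinAbs.natAbs : ℕ) : ℝ)))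
      = exp (-(κ * ∑ i, (((y' i - y i).valMinAbs.natAbs : ℕ) : ℝ))) ^ 2 := by rw [sq, ← exp_add]; ring_nf
  have hR : 0 ≤ ((n : ℝ) + 1) ^ d * (m⁻¹ * exp (2 * d * κ)) * exp (-(κ * ∑ i, (((y' i - y i).valMinAbs.natAbs : ℕ) : ℝ))) := by
    positivity
  have hsq : (∑ z : Fin d → Fin (n + 1), |v (siteOf d ((n + 1) * s) (chart n (windowMap d s y') z))|) ^ 2
      ≤ (((n : ℝ) + 1) ^ d * (m⁻¹ * exp (2 * d * κ)) * exp (-(κ * ∑ i, (((y' i - y i).valMinAbs.natAbs : ℕ) : ℝ)))) ^ 2 := by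
    refine hCS.trans ?_
    calc ((n : ℝ) + 1) ^ d * ∑ z : Fin d → Fin (n + 1), v (siteOf d ((n + 1) * s) (chart n (windowMap d s y') z)) ^ 2
        ≤ ((n : ℝ) + 1) ^ d * ((m⁻¹) ^ 2 * exp (4 * d * κ)
            * exp (-(2 * κ * ∑ i, (((y' i - y i).valMinAbs.natAbs : ℕ) : ℝ))) * ∑ x, g x ^ 2) :=
          mul_le_mul_of_nonneg_left hcol hvol.le
      _ ≤ ((n : ℝ) + 1) ^ d * ((m⁻¹) ^ 2 * exp (4 * d * κ)
            * exp (-(2 * κ * ∑ i, (((y' i - y i).valMinAbs.natAbs : ℕ) : ℝ))) * ((n : ℝ) + 1) ^ d) :=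
          mul_le_mul_of_nonneg_left (mul_le_mul_of_nonneg_left hg2 (by positivity)) hvol.le
      _ = _ := by rw [h4, h5]; ring
  exact (abs_le_of_sq_le_sq' hsq hR).2

variable (y₀ : Site d s) (u f : Site d ((n + 1) * s) → ℝ)
  (hf : ∀ x, |f x| ≤ M * exp (-(γ * ∑ i, ((((siteOf d s (blk n (windowMap d ((n + 1) * s) x))) i - y₀ i).valMinAbs.natAbs : ℕ) : ℝ))))
  (hu : ∀ x, ((n : ℝ) + 1) ^ 2 * ∑ μ, (2 * u x - u (x + siteOf d ((n + 1) * s) (e μ)) - u (x - siteOf d ((n + 1) * s) (e μ)))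
      + a / ((n : ℝ) + 1) ^ d * ∑ q ∈ B n (blk n (windowMap d ((n + 1) * s) x)), u (siteOf d ((n + 1) * s) q) + V x * u x = f x)

include ha hκ0 hκ1 hm hδ hδκ h2δ hV hf hu in
/-- **THE BLOCK-`ℓ¹` NORMS OF `H⁻¹f` INHERIT THE SOURCE'S SUP PROFILE** (road's class `V ≥ −λ`): `|f x| ≤ M·e^{−γρ_s(bt x, y₀)}`, `δ ≤ κ`,
`2δ ≤ γ` ⟹ `Σ_z |u(σ(chart (wm y) z))| ≤ (n+1)^d·m_κ⁻¹e^{2dκ}·M·K_δ·e^{−δρ_s(y,y₀)}` — duality ((133)) against the sign source `𝟙_{B_y}·sgn u`,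
its `H⁻¹` block-`ℓ¹` local (`unitBlockSource_blockL1_le`), and (138) `coarse_convolution_le`. [folklore] -/
theorem blockL1_le_of_supProfile (y : Site d s) :
    ∑ z : Fin d → Fin (n + 1), |u (siteOf d ((n + 1) * s) (chart n (windowMap d s y) z))|
      ≤ ((n : ℝ) + 1) ^ d * ((min 2 a - lam - 2 * d * κ ^ 2 - a * (exp (2 * d * κ) - 1))⁻¹ * exp (2 * d * κ)) * M
        * (2 * (1 - exp (-δ))⁻¹) ^ d * exp (-(δ * ∑ i, (((y i - y₀ i).valMinAbs.natAbs : ℕ) : ℝ))) := by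
  classical
  set m := min 2 a - lam - 2 * d * κ ^ 2 - a * (exp (2 * d * κ) - 1) with hm_def
  have hvol : (0 : ℝ) < ((n : ℝ) + 1) ^ d := by positivity
  have hminv : 0 ≤ m⁻¹ := inv_nonneg.2 hm.le
  have hm0 : 0 < min 2 a - lam := floor_pos_of_rate (d := d) ha hκ0 hm
  have hM : 0 ≤ M := by
    have h1 := (abs_nonneg _).trans (hf (siteOf d ((n + 1) * s) (chart n (windowMap d s y₀) 0)))
    exact le_of_mul_le_mul_right (by rw [zero_mul]; exact h1) (exp_pos _)
  -- the sign source of the block `y` and its `H⁻¹`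
  set g : Site d ((n + 1) * s) → ℝ := fun x =>
    (if siteOf d s (blk n (windowMap d ((n + 1) * s) x)) = y then (1 : ℝ) else 0) * (if 0 ≤ u x then 1 else -1) with hg
  have hgsupp : ∀ x, siteOf d s (blk n (windowMap d ((n + 1) * s) x)) ≠ y → g x = 0 := fun x hx => by
    simp only [hg, if_neg hx, zero_mul]
  have hg1 : ∀ x, |g x| ≤ 1 := fun x => by
    simp only [hg]; split_ifs <;> simp
  obtain ⟨v, hv⟩ := action_surjective n a s ha hm0 V hV g
  have hdual : ∑ x, u x * g x = ∑ x, v x * f x := by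
    have h := action_form_symm n a s V u v
    simp only [hu, hv] at h
    rw [← h]
  have hL : ∑ x, u x * g x = ∑ z : Fin d → Fin (n + 1), |u (siteOf d ((n + 1) * s) (chart n (windowMap d s y) z))| := by
    have e1 : ∀ x, u x * g x = (if siteOf d s (blk n (windowMap d ((n + 1) * s) x)) = y then (1 : ℝ) else 0) * |u x| := fun x => by
      simp only [hg]
      split_ifs with h1 h2
      · rw [abs_of_nonneg h2]; ring
      · rw [abs_of_neg (not_le.1 h2)]; ring
      · ring
      · ring
    rw [Finset.sum_congr rfl fun x _ => e1 x, sum_indicator_mul n s y (fun x => |u x|)]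
  -- the pairing `⟨v, f⟩` blockwise against the profile of `f`
  have hblk : ∀ (y' : Site d s) (p : X d), p ∈ B n (windowMap d s y') →
      siteOf d s (blk n (windowMap d ((n + 1) * s) (siteOf d ((n + 1) * s) p))) = y' := fun y' p hp => blockOf_siteOf_of_mem n s hp
  have hterm : ∀ y' : Site d s, |∑ p ∈ B n (windowMap d s y'), v (siteOf d ((n + 1) * s) p) * f (siteOf d ((n + 1) * s) p)|
      ≤ (((n : ℝ) + 1) ^ d * (m⁻¹ * exp (2 * d * κ)) * exp (-(κ * ∑ i, (((y' i - y i).valMinAbs.natAbs : ℕ) : ℝ))))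
        * (M * exp (-(γ * ∑ i, (((y' i - y₀ i).valMinAbs.natAbs : ℕ) : ℝ)))) := by
    intro y'
    calc |∑ p ∈ B n (windowMap d s y'), v (siteOf d ((n + 1) * s) p) * f (siteOf d ((n + 1) * s) p)|
        ≤ ∑ p ∈ B n (windowMap d s y'), |v (siteOf d ((n + 1) * s) p) * f (siteOf d ((n + 1) * s) p)| := Finset.abs_sum_le_sum_abs _ _
      _ ≤ ∑ p ∈ B n (windowMap d s y'), |v (siteOf d ((n + 1) * s) p)|
          * (M * exp (-(γ * ∑ i, (((y' i - y₀ i).valMinAbs.natAbs : ℕ) : ℝ)))) := by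
          refine Finset.sum_le_sum fun p hp => ?_
          rw [abs_mul]
          refine mul_le_mul_of_nonneg_left ?_ (abs_nonneg _)
          have h := hf (siteOf d ((n + 1) * s) p)
          rwa [hblk y' p hp] at h
      _ = (∑ p ∈ B n (windowMap d s y'), |v (siteOf d ((n + 1) * s) p)|)
          * (M * exp (-(γ * ∑ i, (((y' i - y₀ i).valMinAbs.natAbs : ℕ) : ℝ)))) := (Finset.sum_mul _ _ _).symm
      _ ≤ _ := mul_le_mul_of_nonneg_right (unitBlockSource_blockL1_le n a s ha hκ0 hκ1 hm V hV y v g hgsupp hg1 hv y') (by positivity)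
  have hconv := coarse_convolution_le s hδ hδκ h2δ (by positivity : 0 ≤ ((n : ℝ) + 1) ^ d * (m⁻¹ * exp (2 * d * κ))) hM y y₀
    (fun y' => ((n : ℝ) + 1) ^ d * (m⁻¹ * exp (2 * d * κ)) * exp (-(κ * ∑ i, (((y i - y' i).valMinAbs.natAbs : ℕ) : ℝ))))
    (fun y' => M * exp (-(γ * ∑ i, (((y' i - y₀ i).valMinAbs.natAbs : ℕ) : ℝ))))
    (fun y' => by rw [abs_of_nonneg (by positivity)]) (fun y' => by rw [abs_of_nonneg (by positivity)])
  have hsum : |∑ y' : Site d s, ∑ p ∈ B n (windowMap d s y'), v (siteOf d ((n + 1) * s) p) * f (siteOf d ((n + 1) * s) p)|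
      ≤ ∑ y' : Site d s, (((n : ℝ) + 1) ^ d * (m⁻¹ * exp (2 * d * κ)) * exp (-(κ * ∑ i, (((y i - y' i).valMinAbs.natAbs : ℕ) : ℝ))))
        * (M * exp (-(γ * ∑ i, (((y' i - y₀ i).valMinAbs.natAbs : ℕ) : ℝ)))) := by
    refine (Finset.abs_sum_le_sum_abs _ _).trans (Finset.sum_le_sum fun y' _ => ?_)
    rw [(isPseudoDist_torus (d := d) s).symm y y']
    exact hterm y'
  have habs : |∑ y' : Site d s, (((n : ℝ) + 1) ^ d * (m⁻¹ * exp (2 * d * κ)) * exp (-(κ * ∑ i, (((y i - y' i).valMinAbs.natAbs : ℕ) : ℝ))))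
        * (M * exp (-(γ * ∑ i, (((y' i - y₀ i).valMinAbs.natAbs : ℕ) : ℝ))))|
      = ∑ y' : Site d s, (((n : ℝ) + 1) ^ d * (m⁻¹ * exp (2 * d * κ)) * exp (-(κ * ∑ i, (((y i - y' i).valMinAbs.natAbs : ℕ) : ℝ))))
        * (M * exp (-(γ * ∑ i, (((y' i - y₀ i).valMinAbs.natAbs : ℕ) : ℝ)))) :=
    abs_of_nonneg (Finset.sum_nonneg fun _ _ => by positivity)
  rw [← habs] at hsum
  calc ∑ z : Fin d → Fin (n + 1), |u (siteOf d ((n + 1) * s) (chart n (windowMap d s y) z))|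
      = ∑ x, v x * f x := by rw [← hL, hdual]
    _ ≤ |∑ x, v x * f x| := le_abs_self _
    _ = |∑ y' : Site d s, ∑ p ∈ B n (windowMap d s y'), v (siteOf d ((n + 1) * s) p) * f (siteOf d ((n + 1) * s) p)| := by
        rw [sum_fine_eq_sum_blocks n s (fun x => v x * f x)]
    _ ≤ _ := hsum.trans hconv
    _ = _ := by ring

end Profile

/-! ## §2. Near blocks are `ρ_s`-close; cube `ℓ¹` from the near blocks only -/

/-- **NEAR LATTICE BLOCKS PERIODISE TO `ρ_s`-CLOSE TORUS BLOCKS**: `|b i − c i| ≤ 1` for all `i` ⟹ `ρ_s(σ_s b, σ_s c) ≤ d` ((132)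
`natAbs_valMinAbs_le_of_intCast_eq`: the centred representative is minimal). [folklore] -/
theorem near_dist_le (s : ℕ) [NeZero s] {b c : X d} (h : ∀ i, b i - 1 ≤ c i ∧ c i ≤ b i + 1) :
    ∑ i, ((((siteOf d s c) i - (siteOf d s b) i).valMinAbs.natAbs : ℕ) : ℝ) ≤ d := by
  have hterm : ∀ i, ((((siteOf d s c) i - (siteOf d s b) i).valMinAbs.natAbs : ℕ) : ℝ) ≤ 1 := fun i => by
    have h1 := natAbs_valMinAbs_le_of_intCast_eq (s := s) ((siteOf d s c) i - (siteOf d s b) i) (c i - b i)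
      (by simp only [siteOf, Int.cast_sub])
    have h2 : (c i - b i).natAbs ≤ 1 := by
      have := h i
      omega
    exact_mod_cast h1.trans h2
  calc ∑ i, ((((siteOf d s c) i - (siteOf d s b) i).valMinAbs.natAbs : ℕ) : ℝ) ≤ ∑ _i : Fin d, (1 : ℝ) :=
        Finset.sum_le_sum fun i _ => hterm i
    _ = d := by simp

/-- **`ℓ¹` ON A CUBE FROM THE NEAR BLOCK SUMS**: `3m ≤ n+1`, `F ≥ 0`, `Σ_{B n b} F ≤ K` for the `3^d` blocks `b` with `‖b − blk n q‖_∞ ≤ 1` ⟹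
`Σ_{cube q (3m)} F ≤ 3^d·K` ((151) `cube_subset_blocks`, `card_nearBlocks`). [folklore] -/
theorem sum_cube_le_of_near {n m : ℕ} (h3m : 3 * m ≤ n + 1) (q : X d) {F : X d → ℝ} (hF : ∀ p, 0 ≤ F p) {K : ℝ}
    (hK : ∀ b : X d, (∀ i, blk n q i - 1 ≤ b i ∧ b i ≤ blk n q i + 1) → ∑ p ∈ B n b, F p ≤ K) :
    ∑ p ∈ cube q (3 * m), F p ≤ 3 ^ d * K := by
  classical
  set S := (Fintype.piFinset fun i => Finset.Icc (blk n q i - 1) (blk n q i + 1)) with hS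
  have hdisj : (S : Set (X d)).PairwiseDisjoint (B n) := fun b _ b' _ hne => B_disjoint hne
  have hmem : ∀ b ∈ S, ∀ i, blk n q i - 1 ≤ b i ∧ b i ≤ blk n q i + 1 := fun b hb i => by
    rw [hS, Fintype.mem_piFinset] at hb
    exact Finset.mem_Icc.1 (hb i)
  calc ∑ p ∈ cube q (3 * m), F p ≤ ∑ p ∈ S.biUnion (B n), F p :=
        Finset.sum_le_sum_of_subset_of_nonneg (cube_subset_blocks h3m q) fun p _ _ => hF p
    _ = ∑ b ∈ S, ∑ p ∈ B n b, F p := Finset.sum_biUnion hdisj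
    _ ≤ ∑ b ∈ S, K := Finset.sum_le_sum fun b hb => hK b (hmem b hb)
    _ = 3 ^ d * K := by rw [Finset.sum_const, nsmul_eq_mul, card_nearBlocks]

/-- **THE SECOND-DIFFERENCE SUM AT A SITE, FROM THE EQUATION**: if `Hu = f` (displayed action, `a ≥ 0`) then at `x′ = σ(chart n (wm y′) z′)`,
bounds `|f x′| ≤ M·E′`, `|u x′| ≤ E′·S`, `|V x′| ≤ L` and `|(n+1)^{−d}Σ_z u(σ(chart (wm y′) z))| ≤ Cd·M·E′` give
`|Σ_μ(2u x′ − u(x′+ê_μ) − u(x′−ê_μ))| ≤ E′(M + LS + a·Cd·M)∕(n+1)²` ((144) `blockTerm_eq`). [folklore] -/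
theorem laplacian_site_le (n : ℕ) (a : ℝ) (s : ℕ) [NeZero s] (ha : 0 ≤ a) {L M S E' Cd : ℝ} (hL : 0 ≤ L)
    (V u f : Site d ((n + 1) * s) → ℝ)
    (hu : ∀ x, ((n : ℝ) + 1) ^ 2 * ∑ μ, (2 * u x - u (x + siteOf d ((n + 1) * s) (e μ)) - u (x - siteOf d ((n + 1) * s) (e μ)))
      + a / ((n : ℝ) + 1) ^ d * ∑ q ∈ B n (blk n (windowMap d ((n + 1) * s) x)), u (siteOf d ((n + 1) * s) q) + V x * u x = f x)
    (y' : Site d s) (z' : Fin d → Fin (n + 1))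
    (hVx : |V (siteOf d ((n + 1) * s) (chart n (windowMap d s y') z'))| ≤ L)
    (hfx : |f (siteOf d ((n + 1) * s) (chart n (windowMap d s y') z'))| ≤ M * E')
    (hux : |u (siteOf d ((n + 1) * s) (chart n (windowMap d s y') z'))| ≤ E' * S)
    (hmean : |(((n : ℝ) + 1) ^ d)⁻¹ * ∑ z : Fin d → Fin (n + 1), u (siteOf d ((n + 1) * s) (chart n (windowMap d s y') z))| ≤ Cd * M * E') :
    |∑ μ, (2 * u (siteOf d ((n + 1) * s) (chart n (windowMap d s y') z'))
        - u (siteOf d ((n + 1) * s) (chart n (windowMap d s y') z') + siteOf d ((n + 1) * s) (e μ))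
        - u (siteOf d ((n + 1) * s) (chart n (windowMap d s y') z') - siteOf d ((n + 1) * s) (e μ)))|
      ≤ E' * (M + L * S + a * (Cd * M)) / ((n : ℝ) + 1) ^ 2 := by
  have hx := hu (siteOf d ((n + 1) * s) (chart n (windowMap d s y') z'))
  rw [blockTerm_eq n s u y' z', div_eq_mul_inv] at hx
  have hsq : (0 : ℝ) < ((n : ℝ) + 1) ^ 2 := by positivity
  rw [le_div_iff₀ hsq, ← abs_of_pos hsq, ← abs_mul, mul_comm]
  have e : ((n : ℝ) + 1) ^ 2 * ∑ μ, (2 * u (siteOf d ((n + 1) * s) (chart n (windowMap d s y') z'))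
        - u (siteOf d ((n + 1) * s) (chart n (windowMap d s y') z') + siteOf d ((n + 1) * s) (e μ))
        - u (siteOf d ((n + 1) * s) (chart n (windowMap d s y') z') - siteOf d ((n + 1) * s) (e μ)))
      = f (siteOf d ((n + 1) * s) (chart n (windowMap d s y') z'))
        - a * ((((n : ℝ) + 1) ^ d)⁻¹ * ∑ z : Fin d → Fin (n + 1), u (siteOf d ((n + 1) * s) (chart n (windowMap d s y') z)))
        - V (siteOf d ((n + 1) * s) (chart n (windowMap d s y') z')) * u (siteOf d ((n + 1) * s) (chart n (windowMap d s y') z')) := by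
    linarith [hx]
  rw [e]
  have k2 : |a * ((((n : ℝ) + 1) ^ d)⁻¹ * ∑ z : Fin d → Fin (n + 1), u (siteOf d ((n + 1) * s) (chart n (windowMap d s y') z)))|
      ≤ a * (Cd * M * E') := by
    rw [abs_mul, abs_of_nonneg ha]; exact mul_le_mul_of_nonneg_left hmean ha
  have k3 : |V (siteOf d ((n + 1) * s) (chart n (windowMap d s y') z')) * u (siteOf d ((n + 1) * s) (chart n (windowMap d s y') z'))|
      ≤ L * (E' * S) := by
    rw [abs_mul]; exact mul_le_mul hVx hux (abs_nonneg _) hL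
  have t1 := abs_sub (f (siteOf d ((n + 1) * s) (chart n (windowMap d s y') z'))
    - a * ((((n : ℝ) + 1) ^ d)⁻¹ * ∑ z : Fin d → Fin (n + 1), u (siteOf d ((n + 1) * s) (chart n (windowMap d s y') z))))
    (V (siteOf d ((n + 1) * s) (chart n (windowMap d s y') z')) * u (siteOf d ((n + 1) * s) (chart n (windowMap d s y') z')))
  have t2 := abs_sub (f (siteOf d ((n + 1) * s) (chart n (windowMap d s y') z')))
    (a * ((((n : ℝ) + 1) ^ d)⁻¹ * ∑ z : Fin d → Fin (n + 1), u (siteOf d ((n + 1) * s) (chart n (windowMap d s y') z))))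
  have e2 : E' * (M + L * S + a * (Cd * M)) = M * E' + a * (Cd * M * E') + L * (E' * S) := by ring
  rw [e2]
  linarith

/-! ## §3. Toy -/

/-- Toy (`d = 0`): near blocks of the empty product periodise at distance `0 ≤ 0`. -/
example : ∑ i, ((((siteOf 0 1 (0 : X 0)) i - (siteOf 0 1 (0 : X 0)) i).valMinAbs.natAbs : ℕ) : ℝ) ≤ (0 : ℕ) :=
  near_dist_le (d := 0) 1 (b := 0) (c := 0) fun i => i.elim0

end Summit.QuantumFields.BalabanUV.T4Continuum.NE7b.SupTorusBlockL1Profile
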